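import Mathlib
import Summits.Ventures.PercRepro2.HCov
import Summits.Ventures.PercRepro2.RootLeafUHalf
import Summits.Ventures.PercRepro2.RootLeafUMixK
import Summits.Ventures.PercRepro2.RootLeafUMixKA
import Summits.Ventures.PercRepro2.RootLeafUMixL
import Summits.Ventures.PercRepro2.RootLeafUMixLA
import Summits.Ventures.PercRepro2.RootLeafUMixMax
import Summits.Ventures.PercRepro2.CrossClusterFunctional
import Summits.Ventures.PercRepro2.RootLeafUMixHb
import Summits.Ventures.PercRepro2.RootLeafUMixHbL

/-!
# (G4-u): THE MIXED-COVARIANCE BOUND WITH `ρ = hbL` ON THE `o ∈ L` SIDE — part 2: the theorem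
`hbL_delta_add_bracket_nonneg`: `0 ≤ hbL·δ_o + [(M·W − B₁·Y) − (Y_bK·W − P(R,bK)·Y)]`, i.e. under
`P(· | L avoids {a₂, c})`, `Cov_R(1_{c∈K}·(1_{b∈L} − P(u ↔ b)) − 1_{b∈K}, 1_{o∈L}) ≥ 0` (0 fails / 900, hbclass.py),
and the `hbL`-bound of the `o ∈ L` half `lowL_hb = (|B| − 2β·hbL)·δ_o + (OU)·Y ≤ W·T2oL` with the class
`T2oL_nonneg_of_classL_hb` (blind cell PercRepro2, p4 g14; S3 item (aa); no definitions).  The MIRROR of RootLeafUMixHb with the roles of the roots swapped: the world is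
`R = {L avoids {a₂, c}}` (mass `W = D + t`), the explored cluster is `K = C(a₂)`, `g_L(K) = P(b ∈ C(u) in G ∖ K)`,
`hbL = P(u ↔ b)`; part 1 = RootLeafUMixHbL.
-/

namespace Summit.Ventures.PercRepro2

open UnionCluster CovForm

namespace RootLeafU

namespace MixL

variable {V : Type*} {E : Type*} [Fintype E] [DecidableEq E] [Fintype V] [DecidableEq V]
  {R : Type*} [Field R] [LinearOrder R] [IsStrictOrderedRing R]

section Main

variable (p : E → R) (ends : E → Sym2 V) (o a₂ c b u : V)

omit [Fintype V] [DecidableEq V] [LinearOrder R] [IsStrictOrderedRing R] in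
/-- Linearity of `expect` for a pointwise sum. -/
lemma expect_add_fun_L (f g : Config E → R) :
    expect p (fun ω => f ω + g ω) = expect p f + expect p g :=
  expect_add p f g

omit [LinearOrder R] [IsStrictOrderedRing R] in
/-- **The splitting of `φ(L)·1_R`** (pointwise): `φ(C_u)·1_{a₂↮{u,c}} = 1_{c∈L}·g(L)·1_{u↮a₂} + hb·1_{PD}`. -/
lemma phiL_mul_R_eq (ω : Config E) :
    (({W : Set V | c ∈ W}).indicator (delClusterProb p ends u {W : Set V | b ∈ W}) (cluster ends ω a₂) +
        ({W : Set V | c ∉ W}).indicator (fun _ => prob p (connEvent ends u b)) (cluster ends ω a₂)) *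
      (avoidAll ends u {a₂, c}).indicator 1 ω =
    ({W : Set V | c ∈ W}).indicator (1 : Set V → R) (cluster ends ω a₂) *
        delClusterProb p ends u {W : Set V | b ∈ W} (cluster ends ω a₂) *
        (avoidAll ends a₂ {u}).indicator 1 ω +
      prob p (connEvent ends u b) * (PDEvent ends u a₂ c).indicator 1 ω := by
  have hPD : PDEvent ends u a₂ c = avoidAll ends u {a₂, c} ∩ (connEvent ends a₂ c)ᶜ :=
    ISplit.PD_eq_R_inter ends u a₂ c
  by_cases hc : Conn ends ω a₂ c
  · have h1 : cluster ends ω a₂ ∈ {W : Set V | c ∈ W} := hc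
    have h2 : cluster ends ω a₂ ∉ {W : Set V | c ∉ W} := fun h => h hc
    have h3 : ω ∉ PDEvent ends u a₂ c := by
      rw [hPD]
      exact fun h => h.2 hc
    rw [Set.indicator_of_mem h1, Set.indicator_of_notMem h2, Set.indicator_of_mem h1,
      Set.indicator_of_notMem h3]
    by_cases hR : ω ∈ avoidAll ends u {a₂, c}
    · rw [Set.indicator_of_mem hR, Set.indicator_of_mem ((MixK.mem_R_iff_of_conn ends u c a₂ hc).1 hR)]
      simp
    · rw [Set.indicator_of_notMem hR,
        Set.indicator_of_notMem (fun h => hR ((MixK.mem_R_iff_of_conn ends u c a₂ hc).2 h))]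
      simp
  · have h1 : cluster ends ω a₂ ∉ {W : Set V | c ∈ W} := hc
    have h2 : cluster ends ω a₂ ∈ {W : Set V | c ∉ W} := hc
    rw [Set.indicator_of_notMem h1, Set.indicator_of_mem h2, Set.indicator_of_notMem h1]
    by_cases hR : ω ∈ avoidAll ends u {a₂, c}
    · have h3 : ω ∈ PDEvent ends u a₂ c := by
        rw [hPD]
        exact ⟨hR, hc⟩
      rw [Set.indicator_of_mem hR, Set.indicator_of_mem h3]
      simp
    · have h3 : ω ∉ PDEvent ends u a₂ c := by
        rw [hPD]
        exact fun h => hR h.1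
      rw [Set.indicator_of_notMem hR, Set.indicator_of_notMem h3]
      simp

omit [LinearOrder R] [IsStrictOrderedRing R] in
/-- **The splitting of `1_{o∈K}·φ(L)·1_R`** (pointwise). -/
lemma oL_phiL_mul_R_eq (ω : Config E) :
    ({W : Set V | o ∈ W}).indicator (1 : Set V → R) (cluster ends ω u) *
      (({W : Set V | c ∈ W}).indicator (delClusterProb p ends u {W : Set V | b ∈ W}) (cluster ends ω a₂) +
        ({W : Set V | c ∉ W}).indicator (fun _ => prob p (connEvent ends u b)) (cluster ends ω a₂)) *
      (avoidAll ends u {a₂, c}).indicator 1 ω =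
    ({W : Set V | c ∈ W}).indicator (1 : Set V → R) (cluster ends ω a₂) *
        delClusterProb p ends u {W : Set V | b ∈ W} (cluster ends ω a₂) *
        (connEvent ends u o).indicator 1 ω * (avoidAll ends a₂ {u}).indicator 1 ω +
      prob p (connEvent ends u b) * (PDEvent ends u a₂ c ∩ connEvent ends u o).indicator 1 ω := by
  have h := phiL_mul_R_eq p ends a₂ c b u ω
  rw [MixK.indicator_mem_cluster_eq ends u o ω]
  have e : (PDEvent ends u a₂ c ∩ connEvent ends u o).indicator (1 : Config E → R) ω =
      (PDEvent ends u a₂ c).indicator 1 ω * (connEvent ends u o).indicator 1 ω := by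
    by_cases h1 : ω ∈ PDEvent ends u a₂ c <;> by_cases h2 : ω ∈ connEvent ends u o <;>
      simp [Set.indicator, h1, h2]
  rw [e]
  calc (connEvent ends u o).indicator (1 : Config E → R) ω *
        (({W : Set V | c ∈ W}).indicator (delClusterProb p ends u {W : Set V | b ∈ W}) (cluster ends ω a₂) +
          ({W : Set V | c ∉ W}).indicator (fun _ => prob p (connEvent ends u b)) (cluster ends ω a₂)) *
        (avoidAll ends u {a₂, c}).indicator 1 ω
      = (connEvent ends u o).indicator (1 : Config E → R) ω *
        ((({W : Set V | c ∈ W}).indicator (delClusterProb p ends u {W : Set V | b ∈ W}) (cluster ends ω a₂) +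
          ({W : Set V | c ∉ W}).indicator (fun _ => prob p (connEvent ends u b)) (cluster ends ω a₂)) *
        (avoidAll ends u {a₂, c}).indicator 1 ω) := by ring
    _ = _ := by rw [h]; ring

/-- **THE MIXED-COVARIANCE BOUND WITH `ρ = hb`**: `0 ≤ hb·ℋ′ + X_b` with `hb = P(a₂ ↔ b)`, i.e. under
`P(· | K avoids {u, c})`, `Cov'(1_{c∈L}·(1_{b∈K} − hb) − 1_{b∈L}, 1_{o∈K}) ≥ 0`.  Proof: the exploration of
`L = C(u)` (`J0L_eq`, `J_le` — Harris in `G ∖ L`), BHK06 Thm 1.4 in functional form for the antitone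
`φ(L) = hb·1_{c∉L} + g(L)·1_{c∈L}` against `1_{o∈K}` (`bhk_cross_functional_avoid`), and the `b ∈ L`
slack `bL_mul_P0_le`. -/
theorem hbL_delta_add_bracket_nonneg (hp : IsProbVec p) :
    0 ≤ prob p (connEvent ends u b) *
          (prob p (TEvent ends u a₂ c) * prob p (PDEvent ends u a₂ c ∩ connEvent ends u o) -
            prob p (PDEvent ends u a₂ c) * prob p (TEvent ends u a₂ c ∩ connEvent ends u o)) +
        (prob p (TEvent ends u a₂ c ∩ (connEvent ends u o ∩ connEvent ends u b)) *
            (prob p (PDEvent ends u a₂ c) + prob p (TEvent ends u a₂ c)) -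
          prob p (TEvent ends u a₂ c ∩ connEvent ends u b) *
            (prob p (PDEvent ends u a₂ c ∩ connEvent ends u o) +
              prob p (TEvent ends u a₂ c ∩ connEvent ends u o)) -
          (prob p (PDEvent ends u a₂ c ∩ (connEvent ends u o ∩ connEvent ends a₂ b)) +
              prob p (TEvent ends u a₂ c ∩ (connEvent ends u o ∩ connEvent ends a₂ b))) *
            (prob p (PDEvent ends u a₂ c) + prob p (TEvent ends u a₂ c)) +
          (prob p (PDEvent ends u a₂ c ∩ connEvent ends a₂ b) +
              prob p (TEvent ends u a₂ c ∩ connEvent ends a₂ b)) *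
            (prob p (PDEvent ends u a₂ c ∩ connEvent ends u o) +
              prob p (TEvent ends u a₂ c ∩ connEvent ends u o))) := by
  classical
  have hφanti := phiL_antitone p ends u c b hp
  have hφ0 := phiL_nonneg p ends u c b hp
  have hF₁ : Monotone (({W : Set V | o ∈ W}).indicator (1 : Set V → R)) :=
    monotone_indicator_one_of_isUpperSet (fun _ _ h ho => h ho)
  have hF₁0 : ∀ S, 0 ≤ ({W : Set V | o ∈ W}).indicator (1 : Set V → R) S :=
    fun S => Set.indicator_apply_nonneg fun _ => zero_le_one
  have hu : a₂ ∈ ({a₂, c} : Finset V) := by simp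
  have key := bhk_cross_functional_avoid p hp ends u a₂ hu hF₁ hF₁0 hφanti hφ0
  -- (e1) `E[1_{o∈K} 1_R] = P_o`
  have e1 : expect p (fun ω => ({W : Set V | o ∈ W}).indicator (1 : Set V → R) (cluster ends ω u) *
      (avoidAll ends u {a₂, c}).indicator 1 ω) =
      prob p (PDEvent ends u a₂ c ∩ connEvent ends u o) +
        prob p (TEvent ends u a₂ c ∩ connEvent ends u o) := by
    rw [← prob_clusterInEvent_inter_eq_expect, ExploreA3.clusterInEvent_mem_eq, Set.inter_comm,
      ← ISplit.prob_PD_add_T p ends u a₂ c (connEvent ends u o)]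
  -- (e2) `P(R) = P₀`
  have e2 : prob p (avoidAll ends u {a₂, c}) =
      prob p (PDEvent ends u a₂ c) + prob p (TEvent ends u a₂ c) := by
    have h := ISplit.prob_PD_add_T p ends u a₂ c Set.univ
    simp only [Set.inter_univ] at h
    exact h.symm
  -- (e3) `E[φ(L) 1_R] = P(T′, bK) + hb·D`
  have e3 : expect p (fun ω =>
      (({W : Set V | c ∈ W}).indicator (delClusterProb p ends u {W : Set V | b ∈ W}) (cluster ends ω a₂) +
        ({W : Set V | c ∉ W}).indicator (fun _ => prob p (connEvent ends u b)) (cluster ends ω a₂)) *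
      (avoidAll ends u {a₂, c}).indicator 1 ω) =
      prob p (TEvent ends u a₂ c ∩ connEvent ends u b) +
        prob p (connEvent ends u b) * prob p (PDEvent ends u a₂ c) := by
    have e : (fun ω =>
        (({W : Set V | c ∈ W}).indicator (delClusterProb p ends u {W : Set V | b ∈ W}) (cluster ends ω a₂) +
          ({W : Set V | c ∉ W}).indicator (fun _ => prob p (connEvent ends u b)) (cluster ends ω a₂)) *
        (avoidAll ends u {a₂, c}).indicator 1 ω) =
        fun ω => ({W : Set V | c ∈ W}).indicator (1 : Set V → R) (cluster ends ω a₂) *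
          delClusterProb p ends u {W : Set V | b ∈ W} (cluster ends ω a₂) *
          (avoidAll ends a₂ {u}).indicator 1 ω +
        prob p (connEvent ends u b) * (PDEvent ends u a₂ c).indicator 1 ω :=
      funext fun ω => phiL_mul_R_eq p ends a₂ c b u ω
    rw [e, expect_add_fun_L p (fun ω => ({W : Set V | c ∈ W}).indicator (1 : Set V → R) (cluster ends ω a₂) *
          delClusterProb p ends u {W : Set V | b ∈ W} (cluster ends ω a₂) *
          (avoidAll ends a₂ {u}).indicator 1 ω)
        (fun ω => prob p (connEvent ends u b) * (PDEvent ends u a₂ c).indicator 1 ω),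
      expect_const_mul, ← prob_eq_expect_indicator, J0L_eq]
  -- (e4) `E[1_{o∈K} φ(L) 1_R] = J + hb·P(PD, oK)`
  have e4 : expect p (fun ω => ({W : Set V | o ∈ W}).indicator (1 : Set V → R) (cluster ends ω u) *
      (({W : Set V | c ∈ W}).indicator (delClusterProb p ends u {W : Set V | b ∈ W}) (cluster ends ω a₂) +
        ({W : Set V | c ∉ W}).indicator (fun _ => prob p (connEvent ends u b)) (cluster ends ω a₂)) *
      (avoidAll ends u {a₂, c}).indicator 1 ω) =
      expect p (fun ω => ({W : Set V | c ∈ W}).indicator (1 : Set V → R) (cluster ends ω a₂) *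
        delClusterProb p ends u {W : Set V | b ∈ W} (cluster ends ω a₂) *
        (connEvent ends u o).indicator 1 ω * (avoidAll ends a₂ {u}).indicator 1 ω) +
        prob p (connEvent ends u b) * prob p (PDEvent ends u a₂ c ∩ connEvent ends u o) := by
    have e : (fun ω => ({W : Set V | o ∈ W}).indicator (1 : Set V → R) (cluster ends ω u) *
        (({W : Set V | c ∈ W}).indicator (delClusterProb p ends u {W : Set V | b ∈ W}) (cluster ends ω a₂) +
          ({W : Set V | c ∉ W}).indicator (fun _ => prob p (connEvent ends u b)) (cluster ends ω a₂)) *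
        (avoidAll ends u {a₂, c}).indicator 1 ω) =
        fun ω => ({W : Set V | c ∈ W}).indicator (1 : Set V → R) (cluster ends ω a₂) *
          delClusterProb p ends u {W : Set V | b ∈ W} (cluster ends ω a₂) *
          (connEvent ends u o).indicator 1 ω * (avoidAll ends a₂ {u}).indicator 1 ω +
        prob p (connEvent ends u b) * (PDEvent ends u a₂ c ∩ connEvent ends u o).indicator 1 ω :=
      funext fun ω => oL_phiL_mul_R_eq p ends o a₂ c b u ω
    rw [e, expect_add_fun_L p (fun ω => ({W : Set V | c ∈ W}).indicator (1 : Set V → R) (cluster ends ω a₂) *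
          delClusterProb p ends u {W : Set V | b ∈ W} (cluster ends ω a₂) *
          (connEvent ends u o).indicator 1 ω * (avoidAll ends a₂ {u}).indicator 1 ω)
        (fun ω => prob p (connEvent ends u b) * (PDEvent ends u a₂ c ∩ connEvent ends u o).indicator 1 ω),
      expect_const_mul, ← prob_eq_expect_indicator]
  rw [e1, e2, e3, e4] at key
  have hJ := JL_le p ends o a₂ c b u hp
  have hbL := YbK_mul_W_le p ends o a₂ c b u hp
  have hP0 : 0 ≤ prob p (PDEvent ends u a₂ c) + prob p (TEvent ends u a₂ c) :=
    add_nonneg (prob_nonneg hp _) (prob_nonneg hp _)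
  have key2 := mul_le_mul_of_nonneg_right (add_le_add_right hJ
    (prob p (connEvent ends u b) * prob p (PDEvent ends u a₂ c ∩ connEvent ends u o))) hP0
  nlinarith [key, key2, hbL]

end Main

section Consequences

variable (p : E → R) (ends : E → Sym2 V) (o a₂ c b u : V)

/-- **The `hbL`-lower bound of the `o ∈ L` half**: `lowL_hb = (|B| − 2β·hbL)·δ_o + (OU)·Y ≤ W·T2oL`
(the mirror identity `W_mul_T2oL_eq` with the bracket `≥ −hbL·δ_o`); sharper than the ρ = 1 bound `lowL` of
RootLeafUMixSum by `2β·(1 − hbL)·δ_o ≥ 0`. -/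
theorem lowL_hb_le_W_mul_T2oL (hp : IsProbVec p) :
    ((prob p Set.univ * EQb3 p ends u a₂ c b + prob p Set.univ * PDb p ends u a₂ c b +
            prob p (connEvent ends a₂ b) * EQ3 p ends u a₂ c +
            prob p (connEvent ends a₂ b) * prob p (avoidAll ends a₂ {u}) -
            (prob p Set.univ - prob p (avoidAll ends a₂ {c})) * gap p ends u a₂ b) -
          (prob p (PDEvent ends u a₂ c) * prob p (connEvent ends a₂ b) +
            prob p (avoidAll ends a₂ {c}) * gap p ends u a₂ b) -
        2 * (prob p Set.univ * prob p (PDEvent ends u a₂ c) +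
          prob p (avoidAll ends a₂ {c}) * prob p (avoidAll ends a₂ {u})) *
          prob p (connEvent ends u b)) *
        (prob p (TEvent ends u a₂ c) * prob p (PDEvent ends u a₂ c ∩ connEvent ends u o) -
          prob p (PDEvent ends u a₂ c) * prob p (TEvent ends u a₂ c ∩ connEvent ends u o)) +
      T2oL p ends u a₂ c b u *
        (prob p (PDEvent ends u a₂ c ∩ connEvent ends u o) +
          prob p (TEvent ends u a₂ c ∩ connEvent ends u o)) ≤
    (prob p (PDEvent ends u a₂ c) + prob p (TEvent ends u a₂ c)) * T2oL p ends o a₂ c b u := by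
  have hid := W_mul_T2oL_eq p ends o a₂ c b u
  have hm := hbL_delta_add_bracket_nonneg p ends o a₂ c b u hp
  have hβ : 0 ≤ prob p Set.univ * prob p (PDEvent ends u a₂ c) +
      prob p (avoidAll ends a₂ {c}) * prob p (avoidAll ends a₂ {u}) :=
    add_nonneg (mul_nonneg (prob_nonneg hp _) (prob_nonneg hp _))
      (mul_nonneg (prob_nonneg hp _) (prob_nonneg hp _))
  rw [hid]
  nlinarith [mul_nonneg hβ hm]

/-- **The `o ∈ L` half on the class `(2β·hbL + B)·δ_o ≤ (OU)·Y`** (`B = α − κ ≤ 0`): `0 ≤ T2oL` (contains the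
class `(2β + B)·δ_o ≤ (OU)·Y` of RootLeafUMixLA, since `hbL ≤ 1` and `δ_o ≥ 0`). -/
theorem T2oL_nonneg_of_classL_hb (hp : IsProbVec p)
    (hcls : (2 * (prob p Set.univ * prob p (PDEvent ends u a₂ c) +
          prob p (avoidAll ends a₂ {c}) * prob p (avoidAll ends a₂ {u})) *
          prob p (connEvent ends u b) +
        ((prob p (PDEvent ends u a₂ c) * prob p (connEvent ends a₂ b) +
            prob p (avoidAll ends a₂ {c}) * gap p ends u a₂ b) -
          (prob p Set.univ * EQb3 p ends u a₂ c b + prob p Set.univ * PDb p ends u a₂ c b +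
            prob p (connEvent ends a₂ b) * EQ3 p ends u a₂ c +
            prob p (connEvent ends a₂ b) * prob p (avoidAll ends a₂ {u}) -
            (prob p Set.univ - prob p (avoidAll ends a₂ {c})) * gap p ends u a₂ b))) *
        (prob p (TEvent ends u a₂ c) * prob p (PDEvent ends u a₂ c ∩ connEvent ends u o) -
          prob p (PDEvent ends u a₂ c) * prob p (TEvent ends u a₂ c ∩ connEvent ends u o)) ≤
      T2oL p ends u a₂ c b u *
        (prob p (PDEvent ends u a₂ c ∩ connEvent ends u o) +
          prob p (TEvent ends u a₂ c ∩ connEvent ends u o))) :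
    0 ≤ T2oL p ends o a₂ c b u := by
  apply T2oL_nonneg_of_mixL p ends o a₂ c b u hp
  have hm := hbL_delta_add_bracket_nonneg p ends o a₂ c b u hp
  have hβ : 0 ≤ prob p Set.univ * prob p (PDEvent ends u a₂ c) +
      prob p (avoidAll ends a₂ {c}) * prob p (avoidAll ends a₂ {u}) :=
    add_nonneg (mul_nonneg (prob_nonneg hp _) (prob_nonneg hp _))
      (mul_nonneg (prob_nonneg hp _) (prob_nonneg hp _))
  nlinarith [mul_nonneg hβ hm]

end Consequences

end MixL

end RootLeafU

end Summit.Ventures.PercRepro2
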